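import Summits.Ventures.Crystal3D.Theorems.StickyWulffConstantPolycrystalWulffBoundRungSuperTreeTexture

/-!
# `PolycrystalWulffBound`, line `PolyDensity`: single-axis twin textures with a HEIGHT-LOCAL azimuth test,
# in the crux's own energy (`rung_singleAxis_slabs_texture`; crux `stmt-Ventures-19482`)

Route `StickyWulffConstant` of the venture `Summits/Ventures/Crystal3D`, second prover lane (poly-p2,
gen 13).  Texture (En) form of `rung_singleAxis_slabs`: a crux texture `Tex n G A c m` presented by cells,
whose GRAINS are sorted into `δ`-spaced horizontal slabs (`sl f`; a grain crossing a cut is to be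
presented as two grains with the same frame — equal lattices are free in `Tex`), all frames co-axial with
`A₀` about `m₀`, Bool labels = lattice classes, wall data `m f g = m₀` across the classes, one
(bond, `⟨112⟩`) pair `(uS F, wS F)` PER SLAB, and the aggregate azimuth test with the slab-wise
directions ⇒ `6·2^{1/3}(√2·Vol)^{2/3} ≤ En n G A c m`.  Instance of `rung_superTree_texture` (path tree
of slabs, one reference frame, profile condition `rfl`).
WHAT THIS IS NOT: textures balanced in azimuth inside one slab; the crux is not claimed.
-/

noncomputable section

open scoped BigOperators InnerProductSpace ENNReal Pointwise
open MeasureTheory Filter Set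

namespace Summit.Ventures.Crystal3D.Cruxes.PolycrystalWulffBound.PolyDensity

open Summit.Ventures.Crystal3D.Theorems
open Summit.Ventures.Crystal3D.Cruxes.TextureLiminf.TexShadow (per polytope facetArea supportFn E3)
open Literature.MathematicalPhysics.StatisticalMechanics (fccStacking barlowStacking IsHaggSeq perimeter)

/-- **Rung `rung_singleAxis_slabs_texture`**: single-axis twin textures passing the SLAB-WISE aggregate
azimuth test satisfy `6·2^{1/3}(√2·Vol)^{2/3} ≤ En`. -/
theorem rung_singleAxis_slabs_texture :
    let Λ : Set (EuclideanSpace ℝ (Fin 3)) := Literature.MathematicalPhysics.StatisticalMechanics.fccStacking 1 (Real.sqrt (2 / 3));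
    let Brl : (ℤ → ℤ) → Set (EuclideanSpace ℝ (Fin 3)) := Literature.MathematicalPhysics.StatisticalMechanics.barlowStacking 1 (Real.sqrt (2 / 3));
    let Ax : EuclideanSpace ℝ (Fin 3) → (EuclideanSpace ℝ (Fin 3) ≃ₗᵢ[ℝ] EuclideanSpace ℝ (Fin 3)) → (EuclideanSpace ℝ (Fin 3) ≃ₗᵢ[ℝ] EuclideanSpace ℝ (Fin 3)) → Prop := fun m A B => ∃ (L : EuclideanSpace ℝ (Fin 3) ≃ₗᵢ[ℝ] EuclideanSpace ℝ (Fin 3)) (s₁ s₂ : EuclideanSpace ℝ (Fin 3)) (σ σ' : ℤ → ℤ), Literature.MathematicalPhysics.StatisticalMechanics.IsHaggSeq σ ∧ Literature.MathematicalPhysics.StatisticalMechanics.IsHaggSeq σ' ∧ L (EuclideanSpace.single (2 : Fin 3) (1 : ℝ)) = m ∧ A '' Λ ⊆ (fun q => L q + s₁) '' Brl σ ∧ B '' Λ ⊆ (fun q => L q + s₂) '' Brl σ';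
    let CoAx : (EuclideanSpace ℝ (Fin 3) ≃ₗᵢ[ℝ] EuclideanSpace ℝ (Fin 3)) → (EuclideanSpace ℝ (Fin 3) ≃ₗᵢ[ℝ] EuclideanSpace ℝ (Fin 3)) → Prop := fun A B => ∃ m, Ax m A B;
    let Φ : EuclideanSpace ℝ (Fin 3) → ℝ := fun ν => Real.sqrt 2 / 4 * ∑ᶠ w ∈ {w ∈ Λ | ‖w‖ = 1}, |⟪w, ν⟫_ℝ|;
    let Per : Set (EuclideanSpace ℝ (Fin 3)) → Set (EuclideanSpace ℝ (Fin 3)) → ℝ := fun K S => (⨆ (ξ : EuclideanSpace ℝ (Fin 3) → EuclideanSpace ℝ (Fin 3)) (_ : ContDiff ℝ 1 ξ ∧ HasCompactSupport ξ ∧ ∀ z, ξ z ∈ K), ENNReal.ofReal (∫ z in S, Literature.MathematicalPhysics.StatisticalMechanics.fieldDivergence ξ z)).toReal;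
    let ι : Set (EuclideanSpace ℝ (Fin 3)) → Set (EuclideanSpace ℝ (Fin 3)) → Set (EuclideanSpace ℝ (Fin 3)) → ℝ := fun K S₁ S₂ => (Per K S₁ + Per K S₂ - Per K (S₁ ∪ S₂)) / 2;
    let W : (EuclideanSpace ℝ (Fin 3) ≃ₗᵢ[ℝ] EuclideanSpace ℝ (Fin 3)) → Set (EuclideanSpace ℝ (Fin 3)) := fun A => {y | ∀ ν : EuclideanSpace ℝ (Fin 3), ⟪y, ν⟫_ℝ ≤ Φ (A.symm ν)};
    let Dsc : EuclideanSpace ℝ (Fin 3) → Set (EuclideanSpace ℝ (Fin 3)) := fun m => {y | ‖y‖ ≤ 1 ∧ ⟪y, m⟫_ℝ = 0};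
    let Tex : (n : ℕ) → (Fin n → Set (EuclideanSpace ℝ (Fin 3))) → (Fin n → (EuclideanSpace ℝ (Fin 3) ≃ₗᵢ[ℝ] EuclideanSpace ℝ (Fin 3))) → (Fin n → Fin n → ℝ) → (Fin n → Fin n → EuclideanSpace ℝ (Fin 3)) → Prop := fun n G A c m => (∀ f : Fin n, Literature.MathematicalPhysics.StatisticalMechanics.HasFinitePerimeter (G f) ∧ volume (G f) < ⊤) ∧ (∀ f g, f ≠ g → Disjoint (G f) (G g)) ∧ (∀ f g, f ≠ g → 0 ≤ c f g) ∧ (∀ f g, f ≠ g → ¬ CoAx (A f) (A g) → m f g = 0 ∧ 1 ≤ c f g) ∧ (∀ f g, f ≠ g → CoAx (A f) (A g) → A f '' Λ ≠ A g '' Λ → Ax (m f g) (A f) (A g) ∧ 1 / 2 ≤ c f g);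
    let En : (n : ℕ) → (Fin n → Set (EuclideanSpace ℝ (Fin 3))) → (Fin n → (EuclideanSpace ℝ (Fin 3) ≃ₗᵢ[ℝ] EuclideanSpace ℝ (Fin 3))) → (Fin n → Fin n → ℝ) → (Fin n → Fin n → EuclideanSpace ℝ (Fin 3)) → ℝ := fun n G A c m => ∑ f : Fin n, Per (W (A f)) (G f) - ∑ f, ∑ g, (if f = g then 0 else ι (W (A f)) (G f) (G g)) + ∑ f, ∑ g, (if f = g then 0 else c f g / 2 * ι (Dsc (m f g)) (G f) (G g));
    let Vol : (n : ℕ) → (Fin n → Set (EuclideanSpace ℝ (Fin 3))) → ℝ := fun n G => (volume (⋃ f : Fin n, G f)).toReal;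
    ∀ (k' : ℕ) (Hc : Fin k' → Finset ((EuclideanSpace ℝ (Fin 3)) × ℝ)) (nv : Fin k' → Fin k' → EuclideanSpace ℝ (Fin 3)),
      (∀ j, Bornology.IsBounded (polytope (Hc j))) →
      (∀ j j', j ≠ j' → Disjoint (polytope (Hc j)) (polytope (Hc j'))) →
      (∀ i j, nv j i = -nv i j) →
      (∀ j j', j ≠ j' → ‖nv j j'‖ = 1 ∧ ∃ b : ℝ,
        closure (polytope (Hc j)) ∩ closure (polytope (Hc j')) ⊆ {x | ⟪nv j j', x⟫_ℝ = b}) →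
    ∀ (n : ℕ) (G : Fin n → Set (EuclideanSpace ℝ (Fin 3)))
      (A : Fin n → (EuclideanSpace ℝ (Fin 3) ≃ₗᵢ[ℝ] EuclideanSpace ℝ (Fin 3)))
      (c : Fin n → Fin n → ℝ) (m : Fin n → Fin n → EuclideanSpace ℝ (Fin 3)),
      Tex n G A c m →
    ∀ (s : Fin n → Finset (Fin k')),
      (∀ f, G f = ⋃ j ∈ s f, polytope (Hc j)) →
      (∀ f g, f ≠ g → Disjoint (s f) (s g)) →
      (∀ j, ∃ f, j ∈ s f) →
    ∀ (τ : Fin n → Bool) (N : ℕ) (cut : Fin N → ℝ) (sl : Fin n → Fin (N + 1))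
      (A₀ : EuclideanSpace ℝ (Fin 3) ≃ₗᵢ[ℝ] EuclideanSpace ℝ (Fin 3)) (m₀ : EuclideanSpace ℝ (Fin 3))
      (uS wS : Fin (N + 1) → EuclideanSpace ℝ (Fin 3)) (δ : ℝ),
      ‖m₀‖ = 1 → 0 < δ → (∀ i i' : Fin N, i < i' → cut i + δ ≤ cut i') →
      (∀ (i : Fin N) f, sl f = i.succ → ∀ x ∈ G f, cut i < ⟪x, m₀⟫_ℝ) →
      (∀ (i : Fin N) f, sl f = i.castSucc → ∀ x ∈ G f, ⟪x, m₀⟫_ℝ < cut i) →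
      (∀ f, Ax m₀ A₀ (A f)) → (∀ f g, Ax m₀ (A f) (A g)) →
      (∀ F, ‖uS F‖ = 1 ∧ ‖wS F‖ = 1 ∧ ⟪uS F, m₀⟫_ℝ = 0 ∧ ⟪wS F, m₀⟫_ℝ = 0 ∧ ⟪wS F, uS F⟫_ℝ = 0) →
      (∀ F, uS F ∈ A₀ '' Λ ∧ (ℝ ∙ uS F)ᗮ.reflection '' (A₀ '' Λ) = A₀ '' Λ) →
      (∀ f g, τ f = τ g ↔ A f '' Λ = A g '' Λ) →
      (∀ f g, f ≠ g → τ f ≠ τ g → m f g = m₀) →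
      2 / Real.sqrt 6 * ∑ f, ∑ g, (if (sl f = sl g ∧ τ f ≠ τ g) then
          ∑ a ∈ s f, ∑ b ∈ s g, |⟪wS (sl f), nv a b⟫_ℝ| *
            facetArea (closure (polytope (Hc a)) ∩ closure (polytope (Hc b))) (nv a b) else 0) ≤
        1 / 2 * ∑ f, ∑ g, (if (sl f = sl g ∧ τ f ≠ τ g) then
          ∑ a ∈ s f, ∑ b ∈ s g, Real.sqrt (1 - ⟪nv a b, m₀⟫_ℝ ^ 2) *
            facetArea (closure (polytope (Hc a)) ∩ closure (polytope (Hc b))) (nv a b) else 0) →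
    6 * (2 : ℝ) ^ ((1 : ℝ) / 3) * (Real.sqrt 2 * Vol n G) ^ ((2 : ℝ) / 3) ≤ En n G A c m := by
  intro Λ Brl Ax CoAx Φ Per ι W Dsc Tex En Vol k' Hc nv hbd hdisjQ hanti hplane n G A c m hTex
    s hGs hsdisj hcov τ N cut sl A₀ m₀ uS wS δ hm hδ hcut hup hdown hAx0 hAxP hON hBM hτ hmax hAz
  -- cells of non-adjacent slabs are `δ`-apart along `m₀`
  have hfar : ∀ f g, sl f ≠ sl g → (∀ i : Fin N, ¬ (sl f = i.castSucc ∧ sl g = i.succ)) →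
      (∀ i : Fin N, ¬ (sl g = i.castSucc ∧ sl f = i.succ)) → ∀ x ∈ G f, ∀ y ∈ G g, δ ≤ dist x y := by
    intro f g hne h1 h2 x hx y hy
    have key : ∀ (a b : Fin n) (F F' : Fin (N + 1)), sl a = F → sl b = F' → (F : ℕ) + 2 ≤ F' →
        ∀ p ∈ G a, ∀ q ∈ G b, δ ≤ dist p q := by
      intro a b F F' ha hb hFF p hp q hq
      have hF : (F : ℕ) < N := by have := F'.isLt; omega
      set i : Fin N := ⟨F, hF⟩ with hi
      set i' : Fin N := ⟨(F' : ℕ) - 1, by have := F'.isLt; omega⟩ with hi'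
      have hii' : i < i' := by
        rw [Fin.lt_def]; show (F : ℕ) < (F' : ℕ) - 1; omega
      have hslab_a : sl a = i.castSucc := by rw [ha]; ext; simp [hi]
      have hslab_b : sl b = i'.succ := by rw [hb]; ext; simp [hi']; omega
      have e1 : ⟪p, m₀⟫_ℝ < cut i := hdown i a hslab_a p hp
      have e2 : cut i' < ⟪q, m₀⟫_ℝ := hup i' b hslab_b q hq
      have e3 : cut i + δ ≤ cut i' := hcut i i' hii'
      have e4 : ⟪q - p, m₀⟫_ℝ ≤ ‖q - p‖ := by
        have := real_inner_le_norm (q - p) m₀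
        rw [hm, mul_one] at this
        exact this
      rw [inner_sub_left] at e4
      rw [dist_comm, dist_eq_norm]
      linarith
    rcases lt_or_gt_of_ne (fun h : (sl f : ℕ) = sl g => hne (Fin.ext h)) with hlt | hlt
    · have h2' : (sl f : ℕ) + 2 ≤ sl g := by
        by_contra hcon
        have heq : (sl g : ℕ) = sl f + 1 := by omega
        have hF : (sl f : ℕ) < N := by have := (sl g).isLt; omega
        refine h1 ⟨sl f, hF⟩ ⟨?_, ?_⟩
        · ext; simp
        · ext; simp [heq]
      exact key f g (sl f) (sl g) rfl rfl h2' x hx y hy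
    · have h2' : (sl g : ℕ) + 2 ≤ sl f := by
        by_contra hcon
        have heq : (sl f : ℕ) = sl g + 1 := by omega
        have hF : (sl g : ℕ) < N := by have := (sl f).isLt; omega
        refine h2 ⟨sl g, hF⟩ ⟨?_, ?_⟩
        · ext; simp
        · ext; simp [heq]
      rw [dist_comm]
      exact key g f (sl g) (sl f) rfl rfl h2' y hy x hx
  have hR := rung_superTree_texture k' Hc nv hbd hdisjQ hanti hplane n G A c m hTex s hGs hsdisj hcov τ N
    (fun i => i.castSucc) (fun _ => m₀) cut sl (fun _ => A₀) (fun _ => true) (fun _ => m₀) uS wS δ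
    (fun i => le_of_eq (Fin.val_castSucc i)) (fun _ => hm) (fun _ _ => rfl) hup hδ
    (fun i f hf x hx => Or.inl (hdown i f hf x hx)) hfar (fun f h => Bool.noConfusion h)
    (fun f _ => hAx0 f) (fun f g _ _ => hAxP f g) (fun F _ => hON F) (fun F _ => hBM F)
    (fun f g _ => hτ f g) (fun f g hfg _ _ h => hmax f g hfg h)
    (fun i _ => by rw [real_inner_comm]; exact (hON _).2.2.2.1)
    (fun i _ => by rw [real_inner_comm]; exact (hON _).2.2.2.1)
  simp only [true_and] at hR
  exact hR hAz

end Summit.Ventures.Crystal3D.Cruxes.PolycrystalWulffBound.PolyDensity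

end
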